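import Summits.HodgeConjecture.HodgeConjecture.Theorems.PadicSemiregularLiftFermatAnchorAssemblyStubLatticeReduction
import Summits.HodgeConjecture.HodgeConjecture.Theorems.PadicSemiregularLiftHodgeFermatVarietiesStubClaimLevelPullFacts
import Summits.HodgeConjecture.HodgeConjecture.Theorems.PadicSemiregularLiftHodgeFermatVarietiesEigenspaceStructureOfHodgeType

/-!
# Stub `stub_latticeReduction` of line `witt-lift-rigid-mf` (crux `FermatAnchorAssembly`, stmt-HodgeConjecture-14874) modulo its eight printed inputs

Route `PadicSemiregularLift` of `HodgeConjecture`; skeleton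
`Cruxes/FermatAnchorAssembly/Lines/witt_lift_rigid_mf.lean` (gen 6). The registered stub
`stub_latticeReduction` (L5, crux stmt-HodgeConjecture-1334's PRINTED LATTICE LAYER) reads: for a
level `m ≥ 1`, IF every non-empty Hodge multiset `s` of `ℤ/m` that is not stably reachable from
the printed supply becomes claimed after some level raising `(k+1) • s` and some pair inflation
`+ Σ_{a ∈ A} {a, −a}` (`a ≠ 0`), THEN the Hodge conjecture holds for every smooth projective
Fermat variety of degree `m`.

The tree already holds the kernel-checked reduction `latticeReduction_of_cancelLatticeStubs`
(`Theorems/PadicSemiregularLiftFermatAnchorAssemblyStubLatticeReduction.lean`, p141595) of this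
statement to three antecedents: (i) the conjunction of the five Literature named facts
`Aoki1987_claim_juxtaposition ∧ Aoki1987_claim_of_claim_juxtaposition_paired ∧
Aoki1987_claim_pStandard ∧ AokiShioda1983_eigenline_le_neronSeveri ∧
Shioda1979_claim_semiDecomposable` (crux 1334's S0); (ii) claim pull-back along the level map
`[xᵢ] ↦ [xᵢᵏ]` (crux 1334's S2↑), which the tree proves from the two named facts
`fulton1998_map_mem_algebraicClasses` (Fulton, Cor. 19.2 (b)) and
`bredon1997_quotient_cohomology_invariants` (Bredon II.19.2 with III.1.1) as
`CancelByAnyClaimLattice.stub_claimLevelPull_of_facts` (p141011's sequel); (iii) the Hodge types of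
the zero-free eigenlines, `(p,p)` case (crux 1334's S5b = Ran 1980 Prop. 1.7 (ii)), which is
VERBATIM the named fact `Ran1980_fermatEigenspace_hodgeType_pp`
(`Literature/AlgebraicGeometry/HodgeTheory/FermatEigenspaceHodgeTypes.lean`).

None of these eight named facts has a `_holds` theorem in the tree (checked 2026-08-17: only the
conditional `Aoki1987_claim_juxtaposition_holds_of`, `Aoki1987_claim_pStandard_holds_of`,
`AokiShioda1983_eigenline_le_neronSeveri_of_lefschetzOneOne`, `Shioda1979_claim_semiDecomposable_of_*`,
`fulton1998_map_mem_algebraicClasses_of_graph` exist), so the stub is landed here in its HONEST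
CONDITIONAL FORM `stub_latticeReduction_of_facts` (registered sub-goal of stmt-HodgeConjecture-14874):
the eight printed theorems, as antecedents, imply the registered statement of
`stub_latticeReduction` verbatim. The proof is the one-line composition of
`latticeReduction_of_cancelLatticeStubs` with `stub_claimLevelPull_of_facts` and the Ran fact; hence
`stub_latticeReduction = stub_latticeReduction_of_facts h₁ … h₈` the day the eight `_holds` land.

References: [Aoki1987] N. Aoki, Some new algebraic cycles on Fermat varieties, J. Math. Soc. Japan
39 (1987) 385–396, Thm 1-4 (i), (ii) (p. 388), Thm 2-1, Cor. 2-3; [AokiShioda1983] N. Aoki,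
T. Shioda, Generators of the Néron–Severi group of a Fermat surface, (2.1); [Shioda1979PJA]
T. Shioda, The Hodge conjecture and the Tate conjecture for Fermat varieties, Proc. Japan Acad. 55A
(1979) 111–114; [ShiodaKatsura1979] T. Shioda, T. Katsura, On Fermat varieties, Tôhoku Math. J. 31
(1979) §1; [Ran1980] Z. Ran, Cycles on Fermat hypersurfaces, Compositio Math. 42 (1980) Prop. 1.7;
[Fulton1998] W. Fulton, Intersection Theory, 2nd ed., Cor. 19.2 (b); [Bredon1997] G. E. Bredon,
Sheaf Theory, 2nd ed., II Thm. 19.2, III Thm. 1.1.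
-/

-- `Summit.HodgeConjecture.HodgeConjecture.…` is the tree's mandated summit/problem namespace (single-problem summit).
set_option linter.dupNamespace false

noncomputable section

open CategoryTheory AlgebraicGeometry Finset
open Literature.AlgebraicGeometry Literature.AlgebraicGeometry.Motives
open Literature.AlgebraicGeometry.HodgeTheory Literature.AlgebraicGeometry.HodgeTheory.FermatCharacter
open Literature.AlgebraicTopology.SingularHomology
open Summit.HodgeConjecture.HodgeConjecture.Theses.PadicSemiregularLift

namespace Summit.HodgeConjecture.HodgeConjecture.Cruxes.FermatAnchorAssembly.WittLiftRigidMf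

/-! ### Crux 1334's reach vocabulary (LOCAL NOTATIONS, copied verbatim from the skeleton) -/

/-- `Supply[M]` — the printed supply of level `M` (pairs, Hodge 4-multisets, semi-decomposable Hodge
sextuples, Aoki's standard elements). Local notation only (crux 1334). -/
local notation3 (prettyPrint := false) "Supply[" M "]" =>
  ({s : Multiset (ZMod M) | ∃ a : ZMod M, a ≠ 0 ∧ s = ({a, -a} : Multiset (ZMod M))} ∪
    {s : Multiset (ZMod M) | IsHodgeMultiset s ∧ Multiset.card s = 4} ∪
    {s : Multiset (ZMod M) | IsHodgeMultiset s ∧ IsSemiDecomposable s} ∪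
    {s : Multiset (ZMod M) | ∃ (p : ℕ) (a : ZMod M), p.Prime ∧ p ≠ 2 ∧ p ∣ M ∧
        2 < (M / p) / Nat.gcd (ZMod.val a) (M / p) ∧
        s = Multiset.map (fun j : ℕ => a + (j : ZMod M) * ((M / p : ℕ) : ZMod M)) (Multiset.range p) +
              {-((p : ZMod M) * a)}} : Set (Multiset (ZMod M)))

/-- `Reach[M, s]` — ℤ-reachability of `s` from the printed supply of level `M`. Local notation only (crux 1334). -/
local notation3 (prettyPrint := false) "Reach[" M ", " s "]" =>
  ∃ P N : Multiset (Multiset (ZMod M)),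
    (∀ u ∈ P, u ∈ Supply[M]) ∧ (∀ u ∈ N, u ∈ Supply[M]) ∧ s + Multiset.sum N = Multiset.sum P

/-- `LevelRaise[k, m, s]` — pull-back of the value multiset along `[xᵢ] ↦ [xᵢᵏ]`. Local notation only (crux 1334). -/
local notation3 (prettyPrint := false) "LevelRaise[" k ", " m ", " s "]" =>
  Multiset.map (fun a : ZMod m => ((k * ZMod.val a : ℕ) : ZMod (k * m))) s

/-- `StableReach[m, s]` — reachable after some level raising. Local notation only (crux 1334). -/
local notation3 (prettyPrint := false) "StableReach[" m ", " s "]" =>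
  ∃ k : ℕ, 0 < k ∧ Reach[k * m, LevelRaise[k, m, s]]

/-! ### The stub modulo its eight printed inputs -/

/-- **Registered sub-goal `stub_latticeReduction_of_facts`: the lattice layer `stub_latticeReduction`
of line `witt-lift-rigid-mf` from its EIGHT PRINTED INPUTS** (kernel-checked conditional reduction).
Antecedents, all named facts of `Literature/`: Aoki 1987 Thm 1-4 (i) `Aoki1987_claim_juxtaposition`,
Thm 1-4 (ii) `Aoki1987_claim_of_claim_juxtaposition_paired`, Thm 2-1 `Aoki1987_claim_pStandard`;
Aoki–Shioda 1983 (2.1) `AokiShioda1983_eigenline_le_neronSeveri`; Shioda 1979's semi-decomposable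
sextuples `Shioda1979_claim_semiDecomposable`; Fulton Cor. 19.2 (b) `fulton1998_map_mem_algebraicClasses`
and Bredon II.19.2 `bredon1997_quotient_cohomology_invariants` (together: claim pulls back along the
level map `[xᵢ] ↦ [xᵢᵏ]`, `CancelByAnyClaimLattice.stub_claimLevelPull_of_facts`); Ran 1980
Prop. 1.7 (ii), `(p,p)` case, `Ran1980_fermatEigenspace_hodgeType_pp`. Conclusion, verbatim the
registered signature of `stub_latticeReduction`: for `m ≥ 1`, if every non-empty Hodge multiset of
`ℤ/m` that is not stably reachable from the printed supply is claimed after some level raising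
`(k+1) • s` and pair inflation `+ Σ_{a ∈ A} {a, −a}` (`a ≠ 0`), then HC holds for every smooth
projective Fermat variety of degree `m`. Proof: `latticeReduction_of_cancelLatticeStubs` (p141595:
Hodge models, the per-degree assembly `hodgeClasses_algebraic_fermat_of_claims_at'`, the lattice
criterion S1, level change S2, printed supply S3, Pham S5a — all landed) fed (i) the five-fold
conjunction, (ii) `stub_claimLevelPull_of_facts hF hB`, (iii) the Ran fact (definitionally (E4)).
[cite: Aoki1987, Thm. 1-4 (i), (ii) and Cor. 2-3 (p. 388), Thm. 2-1] [cite: Shioda1979PJA, §2 Thm. 1 and §4]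
[cite: ShiodaKatsura1979, §1] [cite: Ran1980, §1 Prop. 1.7] [cite: Fulton1998, §19.2 Cor. 19.2 (b)]
[cite: Bredon1997, II Thm. 19.2 and III Thm. 1.1] -/
theorem stub_latticeReduction_of_facts : Aoki1987_claim_juxtaposition → Aoki1987_claim_of_claim_juxtaposition_paired → Aoki1987_claim_pStandard → AokiShioda1983_eigenline_le_neronSeveri → Shioda1979_claim_semiDecomposable → fulton1998_map_mem_algebraicClasses → bredon1997_quotient_cohomology_invariants → Ran1980_fermatEigenspace_hodgeType_pp → ∀ (m : ℕ) [NeZero m], (∀ s : Multiset (ZMod m), s ≠ 0 → IsHodgeMultiset s → ¬ StableReach[m, s] → ∃ (k : ℕ) (A : Multiset (ZMod ((k + 1) * m))), (∀ a ∈ A, a ≠ 0) ∧ ClaimMultiset ((k + 1) * m) (LevelRaise[k + 1, m, s] + A.bind (fun a ↦ ({a, -a} : Multiset _)))) → ∀ ⦃n : ℕ⦄ ⦃X : SchemeOver ℂ⦄, IsFermatVariety n m X → IsSmoothProjective n X → HodgeConjectureFor n X :=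
  fun hJ hC hS hNS hSemi hF hB hE4 ↦
    latticeReduction_of_cancelLatticeStubs ⟨hJ, hC, hS, hNS, hSemi⟩
      (Summit.HodgeConjecture.HodgeConjecture.Theorems.CancelByAnyClaimLattice.stub_claimLevelPull_of_facts
        hF hB)
      hE4

end Summit.HodgeConjecture.HodgeConjecture.Cruxes.FermatAnchorAssembly.WittLiftRigidMf

end
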